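import Literature.IUT.LogThetaLattice.TensorPackets
import Mathlib.RingTheory.AdjoinRoot
import Mathlib.Algebra.Algebra.Pi
import HarnessLib

/-!
# [IUTchIII] Prop 3.1 (ii): the unprimed direct-summand schema `Prop31ii_directSummand` —
# kernel negative witness, and its truth at mutually isomorphic factors

Proof-only companion to `Literature/IUT/LogThetaLattice/TensorPackets.lean` (abc-iut cell, layer L6;
node IUTchIII:Prop3.1(ii); FACT-LIST row F-2125). L6 ruling D10 (c) / INBOX 2026-08-25T19:28:37Z
(abc-iut-L6-lead → abc-iut-L3-t12): "negative witnesses are WELCOME as proof-only companions … file it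
as `TensorPacketsNegative.lean`".

The landed schema `Prop31ii_directSummand 𝕜 L α v` ([IUTchIII] Proposition 3.1 (ii), p. 93:
"`log(^{A,α}𝓕_v)` forms a direct summand of the ind-topological ring `log(^A𝓕_{v_ℚ})`") was typed as
the existence of a UNITAL `𝕜`-algebra homomorphism `ι : log(^{A,α}𝓕_v) → log(^A𝓕_{v_ℚ})` admitting a
`𝕜`-linear retraction. As recorded in the docstring of the corrected reading `Prop31ii_directSummand'`
(TensorPackets.lean, appended p404534; PROVED unconditionally by abc-iut-L6-t5,
`Prop31ii_directSummand'_of_packets`), the inclusion of a ring-theoretic direct summand is not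
unital, so the unprimed reading is a different statement. This file settles the unprimed schema in
the kernel, in both directions:

* `not_Prop31ii_directSummand_adjoinRoot` — it is FALSE as a universal schema: with one label
  (`A := Unit`) and two places over `v_ℚ` (`Vfib := Bool`) carrying the fields `ℚ(i) = ℚ[X]/(X²+1)`
  and `ℚ = ℚ[X]/(X)`, a unital `ι` would yield a ring homomorphism `ℚ(i) → ℚ` (project the packet
  `log(^A𝓕_{v_ℚ}) ≅ ℚ(i) × ℚ` onto its second factor), i.e. a rational square root of `-1`
  (finding FALSE-AS-TYPED, abc-iut-L3-t12, INBOX 2026-08-25T19:24:37Z — here made a theorem).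
* `Prop31ii_directSummand_of_algEquiv` — it is TRUE whenever the factors `log(^α𝓕_w)`, `w ∈ Vfib`,
  at the label `α` are mutually `𝕜`-isomorphic (as in the intended model of [IUTchIII] Remark 3.1.1
  (i), where every `log(^α𝓕_w)` is a copy of `k̄`): the twisted diagonal `x ↦ (e_w⁻¹ x)_w` is a
  unital embedding `log(^α𝓕_v) → ⊕_w log(^α𝓕_w)` with the retraction "evaluate at `v`", and tensoring
  with the complementary factor `⊗_{β≠α} log(^β𝓕_{v_ℚ})` (split off from `log(^A𝓕_{v_ℚ})`) gives `ι`
  and `ρ`.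

Nothing here bears on Mochizuki's Proposition 3.1 (ii) itself (whose record decl is the primed,
proved reading) or on [IUTchIII] Corollary 3.12; this is a typing record. Tag form
[claim: Mochizuki2012, status: disputed] (D-0012 claim key; the mathematics below is undisputed
commutative algebra).
-/

namespace Literature.IUT.LogThetaLattice

open scoped TensorProduct
open PiTensorProduct Polynomial

universe u v v' w

/-! ### A piece of plumbing: splitting off one tensor factor, as algebras -/

/-- Splitting off one factor of a finite tensor product of commutative algebras:
`⊗_{i} M_i ≅ M_a ⊗ (⊗_{i ≠ a} M_i)` as `R`-algebras, with the evident value on pure tensors.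
[folklore] -/
-- adapted from the private helper of the same name in TensorPacketsProofs.lean (abc-iut-L6-t5)
private theorem exists_algEquiv_piTensorProduct_split {R : Type*} [CommRing R] {ι : Type*}
    [Fintype ι] [DecidableEq ι] (M : ι → Type*) [∀ i, CommRing (M i)] [∀ i, Algebra R (M i)]
    (a : ι) :
    ∃ e : (⨂[R] i, M i) ≃ₐ[R] M a ⊗[R] (⨂[R] i : {i : ι // i ≠ a}, M i.1),
      ∀ x : ∀ i, M i, e (tprod R x) = x a ⊗ₜ tprod R fun i : {i : ι // i ≠ a} => x i.1 := by
  classical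
  let σ : {i // i = a} ⊕ {i // ¬i = a} ≃ ι := Equiv.sumCompl fun i => i = a
  let N : {i // i = a} ⊕ {i // ¬i = a} → Type _ := fun j => M (σ.symm.symm j)
  let E₁ : (⨂[R] i, M i) ≃ₗ[R] ⨂[R] j, N j := PiTensorProduct.reindex R M σ.symm
  let E₂ := (PiTensorProduct.tmulEquivDep R N).symm
  let E₃ : (⨂[R] i₁ : {i // i = a}, N (.inl i₁)) ≃ₗ[R] M a :=
    PiTensorProduct.subsingletonEquiv (⟨a, rfl⟩ : {i // i = a})
  let E : (⨂[R] i, M i) ≃ₗ[R] M a ⊗[R] (⨂[R] i : {i : ι // i ≠ a}, M i.1) :=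
    E₁ ≪≫ₗ E₂ ≪≫ₗ TensorProduct.congr E₃ (LinearEquiv.refl R _)
  have hE : ∀ x : ∀ i, M i, E (tprod R x) = x a ⊗ₜ tprod R fun i : {i : ι // i ≠ a} => x i.1 := by
    intro x
    have h1 : E₃ (tprod R fun i₁ : {i // i = a} => x (σ.symm.symm (.inl i₁))) = x a :=
      PiTensorProduct.subsingletonEquiv_apply_tprod _ _
    have h2 : E (tprod R x) =
        E₃ (tprod R fun i₁ : {i // i = a} => x (σ.symm.symm (.inl i₁))) ⊗ₜ[R]
          tprod R fun i₂ : {i // ¬i = a} => x (σ.symm.symm (.inr i₂)) := by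
      simp only [E, E₁, E₂, N, LinearEquiv.trans_apply, PiTensorProduct.reindex_tprod,
        PiTensorProduct.tmulEquivDep_symm_apply, TensorProduct.congr_tmul]
      rfl
    rw [h2, h1]
    rfl
  let φ : MultilinearMap R M (M a ⊗[R] (⨂[R] i : {i : ι // i ≠ a}, M i.1)) :=
    (E : (⨂[R] i, M i) →ₗ[R] _).compMultilinearMap (tprod R)
  have hφ : ∀ x, φ x = x a ⊗ₜ tprod R fun i : {i : ι // i ≠ a} => x i.1 := fun x => hE x
  let f : (⨂[R] i, M i) →ₐ[R] M a ⊗[R] (⨂[R] i : {i : ι // i ≠ a}, M i.1) :=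
    PiTensorProduct.liftAlgHom φ (by rw [hφ]; rfl) fun x y => by
      rw [hφ, hφ, hφ, Algebra.TensorProduct.tmul_mul_tmul, tprod_mul_tprod]; rfl
  have hf : ∀ z, f z = E z := by
    have h : f.toLinearMap = (E : (⨂[R] i, M i) →ₗ[R] _) :=
      PiTensorProduct.ext (MultilinearMap.ext fun x => by
        simp only [LinearMap.compMultilinearMap_apply, AlgHom.toLinearMap_apply, f,
          PiTensorProduct.liftAlgHom_apply, PiTensorProduct.lift.tprod, φ, LinearEquiv.coe_coe])
    exact fun z => LinearMap.congr_fun h z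
  have hbij : Function.Bijective f := by
    have : (f : (⨂[R] i, M i) → _) = E := funext hf
    rw [this]; exact E.bijective
  exact ⟨AlgEquiv.ofBijective f hbij, fun x => by
    rw [AlgEquiv.ofBijective_apply, hf, hE]⟩

/-! ### The unprimed schema holds at mutually isomorphic factors -/

section Positive

variable (𝕜 : Type u) [Field 𝕜]
variable {A : Type v} [Fintype A] [DecidableEq A]
variable {Vfib : Type v'}
variable (L : A → Vfib → Type w) [∀ α v, CommRing (L α v)] [∀ α v, Algebra 𝕜 (L α v)]

/-- **IUTchIII:Prop3.1(ii)** (p. 93), unprimed typed reading `Prop31ii_directSummand` ("a unital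
`𝕜`-algebra homomorphism `log(^{A,α}𝓕_v) → log(^A𝓕_{v_ℚ})` with a `𝕜`-linear retraction"), PROVED
whenever the factors `log(^α𝓕_w)` (`w ∈ Vfib`) at the label `α` are mutually `𝕜`-isomorphic — e.g.
at the model of [IUTchIII] Remark 3.1.1 (i), where each is a copy of `k̄`: with
`Z := ⊗_{β≠α} log(^β𝓕_{v_ℚ})`, take `ι := (x ⊗ z ↦ (e_w⁻¹ x)_w ⊗ z)` through the splitting
`log(^A𝓕_{v_ℚ}) ≅ (⊕_w log(^α𝓕_w)) ⊗ Z`, and `ρ :=` evaluation at `w = v` (composed with `e_v`).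
FACT-LIST F-2125 disposition, positive half. [claim: Mochizuki2012, status: disputed] -/
theorem Prop31ii_directSummand_of_algEquiv (α : A) (v : Vfib) (e : ∀ w : Vfib, L α w ≃ₐ[𝕜] L α v) :
    Prop31ii_directSummand 𝕜 L α v := by
  classical
  obtain ⟨E, -⟩ := exists_algEquiv_piTensorProduct_split (R := 𝕜) (fun β => Packet1 L β) α
  -- the twisted diagonal `j` and its retraction `q`
  let j : L α v →ₐ[𝕜] Packet1 L α := AlgHom.pi fun w => ((e w).symm : L α v →ₐ[𝕜] L α w)
  let q : Packet1 L α →ₐ[𝕜] L α v := (e v : L α v →ₐ[𝕜] L α v).comp (Pi.evalAlgHom 𝕜 (L α) v)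
  have hqj : ∀ x, q (j x) = x := fun x => by
    simp [q, j]
  let ι : PacketAt 𝕜 L α v →ₐ[𝕜] PacketN 𝕜 L :=
    (E.symm : _ →ₐ[𝕜] PacketN 𝕜 L).comp
      (Algebra.TensorProduct.map j (AlgHom.id 𝕜 (⨂[𝕜] β : {β : A // β ≠ α}, Packet1 L β.1)))
  let π : PacketN 𝕜 L →ₐ[𝕜] PacketAt 𝕜 L α v :=
    (Algebra.TensorProduct.map q (AlgHom.id 𝕜 (⨂[𝕜] β : {β : A // β ≠ α}, Packet1 L β.1))).comp
      (E : PacketN 𝕜 L →ₐ[𝕜] _)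
  refine ⟨ι, π.toLinearMap, fun x => ?_⟩
  change π (ι x) = x
  induction x using TensorProduct.induction_on with
  | zero => simp
  | tmul a z => simp [ι, π, Algebra.TensorProduct.map_tmul, hqj]
  | add x y hx hy => rw [map_add, map_add, hx, hy]

/-- Corollary: the unprimed schema holds at the (abstract form of the) Remark 3.1.1 (i) model with a
SINGLE model field `k̄` over `v_ℚ` — every `log(^α𝓕_w) ≅ k̄` as `𝕜`-algebras.
[claim: Mochizuki2012, status: disputed] -/
theorem Prop31ii_directSummand_of_model (α : A) (v : Vfib) (kbar : Type w) [Field kbar]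
    [Algebra 𝕜 kbar] (e : ∀ w : Vfib, L α w ≃ₐ[𝕜] kbar) : Prop31ii_directSummand 𝕜 L α v :=
  Prop31ii_directSummand_of_algEquiv 𝕜 L α v fun w => (e w).trans (e v).symm

end Positive

/-! ### The unprimed schema is false as a universal statement -/

/-- **IUTchIII:Prop3.1(ii)** (p. 93), unprimed typed reading `Prop31ii_directSummand`, REFUTED as a
universal schema (FACT-LIST F-2125; finding FALSE-AS-TYPED of abc-iut-L3-t12): at `𝕜 := ℚ`, one label
`A := Unit`, two places `Vfib := Bool` with `log(^α𝓕_true) := ℚ[X]/(X²+1) = ℚ(i)` and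
`log(^α𝓕_false) := ℚ[X]/(X) = ℚ`, there is NO unital `ℚ`-algebra homomorphism
`log(^{A,α}𝓕_true) → log(^A𝓕_{v_ℚ})` at all: composing
`ℚ(i) → log(^{A,α}𝓕_true) → log(^A𝓕_{v_ℚ}) → ⊕_w log(^α𝓕_w) → ℚ[X]/(X) → ℚ` would send `i` to a
rational number with square `-1`. (The record decl of the node is the primed reading
`Prop31ii_directSummand'`, proved.) [claim: Mochizuki2012, status: disputed] -/
theorem not_Prop31ii_directSummand_adjoinRoot :
    ¬ Prop31ii_directSummand ℚ
      (fun (_ : Unit) (b : Bool) => AdjoinRoot (cond b (X ^ 2 + 1) X : ℚ[X])) () true := by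
  rintro ⟨ι, -, -⟩
  -- the packet ring `⊗_{Unit} (⊕_b L b)` maps onto `⊕_b L b` as an algebra
  let P : Bool → Type := fun b => AdjoinRoot (cond b (X ^ 2 + 1) X : ℚ[X])
  let f₃ : PacketN ℚ (fun (_ : Unit) (b : Bool) => P b) →ₐ[ℚ] (∀ b, P b) :=
    PiTensorProduct.liftAlgHom
      (MultilinearMap.ofSubsingleton ℚ (∀ b, P b) (∀ b, P b) () LinearMap.id) rfl fun _ _ => rfl
  let f₅ : P false →+* ℚ := AdjoinRoot.lift (RingHom.id ℚ) 0 (by simp)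
  let θ : AdjoinRoot (X ^ 2 + 1 : ℚ[X]) →+* ℚ :=
    f₅.comp ((Pi.evalAlgHom ℚ P false).comp (f₃.comp
      (ι.comp (toPacketAt ℚ (fun (_ : Unit) (b : Bool) => P b) () true)))).toRingHom
  have hr : AdjoinRoot.root (X ^ 2 + 1 : ℚ[X]) ^ 2 + 1 = 0 := by
    have h := AdjoinRoot.eval₂_root (X ^ 2 + 1 : ℚ[X])
    simpa [eval₂_add, eval₂_pow, eval₂_X, eval₂_one] using h
  have h0 : θ (AdjoinRoot.root (X ^ 2 + 1 : ℚ[X])) ^ 2 + 1 = 0 := by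
    have := congrArg θ hr
    simpa [map_add, map_pow, map_one, map_zero] using this
  nlinarith [sq_nonneg (θ (AdjoinRoot.root (X ^ 2 + 1 : ℚ[X])))]

end Literature.IUT.LogThetaLattice
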